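import Summits.Ventures.DiscreteObjects.Hadamard.ConferenceGraph333CompositeOrders
import Summits.Ventures.DiscreteObjects.Hadamard.TwistedTraceFrobenius

/-!
# Automorphisms of srg(333,166,82,83) of order prime to 37 have an ODD number of fixed points; order 17 excluded (kernel)

Framing: lottery ticket; floor = certified bounds/negative ranges.  Cell pub-namedobj (venture DiscreteObjects),
target (H) = `H(668)`, hadamard gen 29: THE GALOIS REFINEMENT of the gen-28 automorphism census of
`srg(333,166,82,83)` ⇔ symmetric `C(334)` (⇒ `H(668)`; `ConferenceGraph333`, `ConferenceRoute668`), in the kernel and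
WITHOUT cyclotomic fields (tool: `TwistedTraceFrobenius.trace_eq_zero_of_pow_eq_smul_333`).  For the Seidel matrix
`S = J − I − 2A` (`S² = 333·I − J`, `S𝟙 = 0`) and an adjacency-preserving permutation `σ` with `σ^n = 1`, the twisted
matrix `M_{xy} = S_{σx,y}` is `P_σ S` with `P_σ S = S P_σ`, `P_σ^n = 1`, `S³ = 333·S`, hence `M^(2n+1) = 333^n·M`; so:
* **`aut_twisted_trace_zero`** — `Σ_x S_{x,σx} = 0` whenever `σ^n = 1` with `37 ∤ n` (gen 28 had `n = 2`,
  `ConferenceGraph333InvolutionEdges`);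
* **`aut_card_fixed_odd`** — hence such a `σ` moves as many vertices to a neighbour as to a non-neighbour, and its
  number of fixed points `f` is ODD (`333 − f` = twice the number of `x` with `x ~ σx`);
* **`no_aut_order_17`** (the gen-28 window was `f = 10`), **`no_aut_pow_eq_one_17`** (no element of order divisible by
  `17`), **`aut_order13_fixed`** (`f = 21`; was `{8, 21}`), **`aut_order5_fixed`** (`f ≡ 3 (mod 10)`, `f ≤ 53`);
* **`aut_prime_spectrum_refined`** — prime orders of automorphisms lie in **`{2, 3, 5, 7, 11, 13, 23, 37, 41, 83}`**, with
  **`aut_prime_windows_refined`**: `3: f ≡ 3 (6), f ≤ 81 · 5: f ≡ 3 (10), f ≤ 53 · 7: {11,25,39} · 11: {3,25} · 13: {21} ·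
  23: {11} · 37: {0} · 41: {5} · 83: {1}` (`2`: `f ≡ 1 (mod 4)`);
* **`aut_two_primes_facts_odd`**, **`no_aut_order_91`** — the `p·q` facts of `ConferenceGraph333CompositeOrders` with the
  three parities added; order `91 = 7·13` is newly excluded (gen 28's only solution had `#Fix τ = 0`).  Script level
  (code/census_g29.py, exact): surviving products of two distinct primes are now
  `6, 10, 14, 15, 21, 22, 26, 33, 35, 39, 46, 55, 65, 69, 74, 77, 82, 161, 166` (gen 28: also `34, 51, 91`).
Galois form of the same fact: `tr(P_σ|E₊) ∈ ℚ(√37) ∩ ℚ(ζ_n) = ℚ` for the `√333`-eigenspace `E₊`.  WORDS: structure of a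
HYPOTHETICAL object; no srg(333,166,82,83) / C(334) / H(668) constructed or excluded.  Ours (PROVISIONAL; method in
print: orbit matrices + character arguments, Behbahani–Lam 2011).  No `sorry`, no new definitions.
-/

namespace Summit.Ventures.DiscreteObjects.Hadamard

open Finset

section oddfixed
variable {V : Type*} [Fintype V] [DecidableEq V]

/-- **Twisted trace.**  For an adjacency-preserving permutation `σ` of an `srg(333,166,82,83)` with `σ^n = 1`,
`37 ∤ n`, the Seidel entries along `σ` sum to zero: `Σ_x S_{x,σx} = 0`, `S_{xy} = 1 − [x=y] − 2A_{xy}`. -/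
theorem aut_twisted_trace_zero (hV : Fintype.card V = 333) (A : Matrix V V ℤ)
    (h01 : ∀ x y, A x y = 0 ∨ A x y = 1) (hsymm : ∀ x y, A y x = A x y) (hdiag : ∀ x, A x x = 0)
    (hk : ∀ x, ∑ y, A x y = 166) (hsrg : ∀ x y, ∑ z, A x z * A z y = 83 * (1 + (if x = y then 1 else 0)) - A x y)
    (σ : Equiv.Perm V) {n : ℕ} (hσ : σ ^ n = 1) (h37 : ¬ 37 ∣ n) (hA : ∀ x y, A (σ x) (σ y) = A x y) :
    ∑ x, (1 - (if x = σ x then (1 : ℤ) else 0) - 2 * A x (σ x)) = 0 := by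
  obtain ⟨-, -, hSs, hS1, hSS⟩ := seidel_identities_of_conferenceGraph A h01 hsymm hdiag 83
    (by rw [hV]; norm_num) (fun x => by rw [hk x]; norm_num) hsrg
  set S : V → V → ℤ := fun x y => 1 - (if x = y then 1 else 0) - 2 * A x y with hS_def
  have hSS' : ∀ x y, ∑ z, S x z * S z y = 333 * (if x = y then 1 else 0) - 1 := fun x y => by
    rw [hSS x y, hV]; norm_num
  have hSσ : ∀ x y, S (σ x) (σ y) = S x y := fun x y => by
    simp only [hS_def, hA, σ.injective.eq_iff]
  have hSs' : ∀ x y, S y x = S x y := fun x y => hSs x y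
  have hScol : ∀ y, ∑ x, S x y = 0 := fun y => by
    rw [Finset.sum_congr rfl fun x _ => hSs' y x]; exact hS1 y
  -- the Seidel matrix and the permutation matrix of σ
  set N : Matrix V V ℤ := Matrix.of fun x y => S x y with hN_def
  set P : Matrix V V ℤ := Matrix.of fun x y => if σ x = y then (1 : ℤ) else 0 with hP_def
  have hPmul : ∀ (X : Matrix V V ℤ) x y, (P * X) x y = X (σ x) y := by
    intro X x y
    rw [Matrix.mul_apply]
    simp only [hP_def, Matrix.of_apply, ite_mul, one_mul, zero_mul]
    rw [Finset.sum_ite_eq]; simp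
  have hmulP : ∀ (X : Matrix V V ℤ) x y, (X * P) x y = X x (σ.symm y) := by
    intro X x y
    rw [Matrix.mul_apply]
    simp only [hP_def, Matrix.of_apply, mul_ite, mul_one, mul_zero]
    have e : ∀ z, (σ z = y) ↔ (z = σ.symm y) := fun z => Equiv.apply_eq_iff_eq_symm_apply σ
    simp_rw [e]
    rw [Finset.sum_ite_eq']; simp
  have hPN : P * N = N * P := by
    ext x y
    rw [hPmul, hmulP]
    simp only [hN_def, Matrix.of_apply]
    have := hSσ x (σ.symm y)
    rwa [Equiv.apply_symm_apply] at this
  have hPpow : ∀ (k : ℕ) x y, (P ^ k) x y = if (σ ^ k) x = y then (1 : ℤ) else 0 := by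
    intro k
    induction k with
    | zero => intro x y; simp [Matrix.one_apply]
    | succ k ih =>
      intro x y
      rw [pow_succ, hmulP, ih, pow_succ', Equiv.Perm.mul_apply]
      have e : ((σ ^ k) x = σ.symm y) ↔ (σ ((σ ^ k) x) = y) := by
        constructor
        · intro h; rw [h, Equiv.apply_symm_apply]
        · intro h; rw [← h, Equiv.symm_apply_apply]
      simp only [e]
  have hPn : P ^ n = 1 := by
    ext x y
    rw [hPpow, hσ, Equiv.Perm.one_apply, Matrix.one_apply]
  -- S³ = 333 S and its odd powers
  have hN2 : ∀ x y, (N * N) x y = 333 * (if x = y then 1 else 0) - 1 := fun x y => by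
    rw [Matrix.mul_apply]; simp only [hN_def, Matrix.of_apply]; exact hSS' x y
  have hN3 : N ^ 3 = (333 : ℤ) • N := by
    ext x y
    rw [pow_succ, pow_two, Matrix.mul_apply, Matrix.smul_apply, smul_eq_mul]
    have e : ∀ w, (N * N) x w * N w y = 333 * (if x = w then S w y else 0) - S w y := by
      intro w; rw [hN2]; simp only [hN_def, Matrix.of_apply]; split_ifs <;> ring
    rw [Finset.sum_congr rfl fun w _ => e w, Finset.sum_sub_distrib, ← Finset.mul_sum, Finset.sum_ite_eq,
      if_pos (Finset.mem_univ _), hScol, sub_zero]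
    simp only [hN_def, Matrix.of_apply]
  have hNpow : ∀ m : ℕ, N ^ (2 * m + 1) = (333 : ℤ) ^ m • N := by
    intro m
    induction m with
    | zero => simp
    | succ m ih =>
      rw [show 2 * (m + 1) + 1 = (2 * m + 1) + 2 by ring, pow_add, ih, smul_mul_assoc, ← pow_succ', hN3, smul_smul,
        pow_succ]
  -- the twisted matrix M = P S
  have hcomm : Commute P N := hPN
  have hM : (P * N) ^ (2 * n + 1) = (333 : ℤ) ^ n • (P * N) := by
    rw [hcomm.mul_pow, hNpow, pow_succ, pow_mul', hPn, one_pow, one_mul, Matrix.mul_smul]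
  have htr := trace_eq_zero_of_pow_eq_smul_333 (P * N) n h37 hM
  have e : (P * N).trace = ∑ x, S x (σ x) := by
    simp only [Matrix.trace, Matrix.diag]
    refine Finset.sum_congr rfl fun x _ => ?_
    rw [hPmul]
    simp only [hN_def, Matrix.of_apply]
    exact hSs' (σ x) x ▸ (hSs' x (σ x)).symm ▸ rfl
  rw [e] at htr
  simpa [hS_def] using htr

/-- **Odd number of fixed points; moved edges = moved non-edges.**  For `σ^n = 1`, `37 ∤ n`, adjacency-preserving:
`#{x : σx ≠ x, x ~ σx} = #{x : σx ≠ x, x ≁ σx}` and the number of fixed points of `σ` is ODD. -/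
theorem aut_card_fixed_odd (hV : Fintype.card V = 333) (A : Matrix V V ℤ)
    (h01 : ∀ x y, A x y = 0 ∨ A x y = 1) (hsymm : ∀ x y, A y x = A x y) (hdiag : ∀ x, A x x = 0)
    (hk : ∀ x, ∑ y, A x y = 166) (hsrg : ∀ x y, ∑ z, A x z * A z y = 83 * (1 + (if x = y then 1 else 0)) - A x y)
    (σ : Equiv.Perm V) {n : ℕ} (hσ : σ ^ n = 1) (h37 : ¬ 37 ∣ n) (hA : ∀ x y, A (σ x) (σ y) = A x y) :
    (univ.filter fun x => σ x ≠ x ∧ A x (σ x) = 1).card = (univ.filter fun x => σ x ≠ x ∧ A x (σ x) = 0).card ∧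
      (univ.filter fun x => σ x = x).card % 2 = 1 := by
  have h := aut_twisted_trace_zero hV A h01 hsymm hdiag hk hsrg σ hσ h37 hA
  have hterm : ∀ x, (1 - (if x = σ x then (1 : ℤ) else 0) - 2 * A x (σ x)) =
      (if σ x ≠ x ∧ A x (σ x) = 0 then 1 else 0) - (if σ x ≠ x ∧ A x (σ x) = 1 then 1 else 0) := by
    intro x
    by_cases hfx : σ x = x
    · rw [hfx, hdiag]; simp
    · have hne : ¬ x = σ x := fun e => hfx e.symm
      rcases h01 x (σ x) with e | e <;> simp [hne, hfx, e]
  rw [Finset.sum_congr rfl fun x _ => hterm x, Finset.sum_sub_distrib, Finset.sum_boole, Finset.sum_boole] at h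
  have h' : ((univ.filter fun x => σ x ≠ x ∧ A x (σ x) = 1).card : ℤ) =
      (univ.filter fun x => σ x ≠ x ∧ A x (σ x) = 0).card := by linear_combination -h
  have h'' : (univ.filter fun x => σ x ≠ x ∧ A x (σ x) = 1).card =
      (univ.filter fun x => σ x ≠ x ∧ A x (σ x) = 0).card := by exact_mod_cast h'
  -- the three classes partition V
  have hone : ∀ x, (if σ x = x then 1 else 0 : ℕ) + (if σ x ≠ x ∧ A x (σ x) = 0 then 1 else 0)
      + (if σ x ≠ x ∧ A x (σ x) = 1 then 1 else 0) = 1 := by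
    intro x
    by_cases hfx : σ x = x
    · simp [hfx]
    · rcases h01 x (σ x) with e | e <;> simp [hfx, e]
  have hsum := Finset.sum_congr rfl fun x (_ : x ∈ (univ : Finset V)) => hone x
  rw [Finset.sum_add_distrib, Finset.sum_add_distrib, Finset.sum_boole, Finset.sum_boole, Finset.sum_boole,
    Finset.sum_const, Finset.card_univ, hV, smul_eq_mul, mul_one] at hsum
  refine ⟨h'', ?_⟩
  simp only [Nat.cast_id] at hsum
  omega

/-- **No automorphism of order `17`.**  (Gen 28's census leaves only the window `f = 10` for `p = 17`; but `f` is odd.) -/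
theorem no_aut_order_17 (hV : Fintype.card V = 333) (A : Matrix V V ℤ)
    (h01 : ∀ x y, A x y = 0 ∨ A x y = 1) (hsymm : ∀ x y, A y x = A x y) (hdiag : ∀ x, A x x = 0)
    (hk : ∀ x, ∑ y, A x y = 166) (hsrg : ∀ x y, ∑ z, A x z * A z y = 83 * (1 + (if x = y then 1 else 0)) - A x y)
    (σ : Equiv.Perm V) (hσ : σ ^ 17 = 1) (hσ1 : σ ≠ 1) (hA : ∀ x y, A (σ x) (σ y) = A x y) : False := by
  obtain ⟨-, -, -, -, -, h17, -⟩ :=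
    aut_prime_windows hV A h01 hsymm hdiag hk hsrg (by norm_num : Nat.Prime 17) (by norm_num) σ hσ hσ1 hA
  have hodd := (aut_card_fixed_odd hV A h01 hsymm hdiag hk hsrg σ hσ (by norm_num) hA).2
  have := h17 rfl
  omega

/-- **No automorphism of order divisible by `17`**: `σ^(17k) = 1` forces `σ^k = 1`. -/
theorem no_aut_pow_eq_one_17 (hV : Fintype.card V = 333) (A : Matrix V V ℤ)
    (h01 : ∀ x y, A x y = 0 ∨ A x y = 1) (hsymm : ∀ x y, A y x = A x y) (hdiag : ∀ x, A x x = 0)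
    (hk : ∀ x, ∑ y, A x y = 166) (hsrg : ∀ x y, ∑ z, A x z * A z y = 83 * (1 + (if x = y then 1 else 0)) - A x y)
    (σ : Equiv.Perm V) (k : ℕ) (hσ : σ ^ (17 * k) = 1) (hA : ∀ x y, A (σ x) (σ y) = A x y) : σ ^ k = 1 := by
  by_contra hne
  have hAk : ∀ (j : ℕ) x y, A ((σ ^ j) x) ((σ ^ j) y) = A x y := by
    intro j; induction j with
    | zero => intro x y; simp
    | succ j ih => intro x y; rw [pow_succ', Equiv.Perm.mul_apply, Equiv.Perm.mul_apply, hA, ih]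
  have h17 : (σ ^ k) ^ 17 = 1 := by rw [← pow_mul, mul_comm, hσ]
  exact no_aut_order_17 hV A h01 hsymm hdiag hk hsrg (σ ^ k) h17 hne (hAk k)

/-- **Order `13`: exactly `21` fixed points** (gen 28: `{8, 21}`). -/
theorem aut_order13_fixed (hV : Fintype.card V = 333) (A : Matrix V V ℤ)
    (h01 : ∀ x y, A x y = 0 ∨ A x y = 1) (hsymm : ∀ x y, A y x = A x y) (hdiag : ∀ x, A x x = 0)
    (hk : ∀ x, ∑ y, A x y = 166) (hsrg : ∀ x y, ∑ z, A x z * A z y = 83 * (1 + (if x = y then 1 else 0)) - A x y)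
    (σ : Equiv.Perm V) (hσ : σ ^ 13 = 1) (hσ1 : σ ≠ 1) (hA : ∀ x y, A (σ x) (σ y) = A x y) :
    (univ.filter fun x => σ x = x).card = 21 := by
  obtain ⟨-, -, -, -, h13, -⟩ :=
    aut_prime_windows hV A h01 hsymm hdiag hk hsrg (by norm_num : Nat.Prime 13) (by norm_num) σ hσ hσ1 hA
  have hodd := (aut_card_fixed_odd hV A h01 hsymm hdiag hk hsrg σ hσ (by norm_num) hA).2
  have := h13 rfl
  omega

/-- **Order `5`: `f ≡ 3 (mod 10)`, `f ≤ 53`** (gen 28: `f ≡ 3 (mod 5)`), i.e. `f ∈ {3, 13, 23, 33, 43, 53}`. -/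
theorem aut_order5_fixed (hV : Fintype.card V = 333) (A : Matrix V V ℤ)
    (h01 : ∀ x y, A x y = 0 ∨ A x y = 1) (hsymm : ∀ x y, A y x = A x y) (hdiag : ∀ x, A x x = 0)
    (hk : ∀ x, ∑ y, A x y = 166) (hsrg : ∀ x y, ∑ z, A x z * A z y = 83 * (1 + (if x = y then 1 else 0)) - A x y)
    (σ : Equiv.Perm V) (hσ : σ ^ 5 = 1) (hσ1 : σ ≠ 1) (hA : ∀ x y, A (σ x) (σ y) = A x y) :
    (univ.filter fun x => σ x = x).card % 10 = 3 ∧ (univ.filter fun x => σ x = x).card ≤ 53 := by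
  obtain ⟨-, h5, -⟩ :=
    aut_prime_windows hV A h01 hsymm hdiag hk hsrg (by norm_num : Nat.Prime 5) (by norm_num) σ hσ hσ1 hA
  have hodd := (aut_card_fixed_odd hV A h01 hsymm hdiag hk hsrg σ hσ (by norm_num) hA).2
  have := h5 rfl
  omega

/-- **Prime-order spectrum, refined.**  A non-identity automorphism `σ` with `σ^p = 1`, `p` prime, has
**`p ∈ {2, 3, 5, 7, 11, 13, 23, 37, 41, 83}`** (`17` is gone). -/
theorem aut_prime_spectrum_refined (hV : Fintype.card V = 333) (A : Matrix V V ℤ)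
    (h01 : ∀ x y, A x y = 0 ∨ A x y = 1) (hsymm : ∀ x y, A y x = A x y) (hdiag : ∀ x, A x x = 0)
    (hk : ∀ x, ∑ y, A x y = 166) (hsrg : ∀ x y, ∑ z, A x z * A z y = 83 * (1 + (if x = y then 1 else 0)) - A x y)
    {p : ℕ} (hp : p.Prime) (σ : Equiv.Perm V) (hσ : σ ^ p = 1) (hσ1 : σ ≠ 1)
    (hA : ∀ x y, A (σ x) (σ y) = A x y) :
    p = 2 ∨ p = 3 ∨ p = 5 ∨ p = 7 ∨ p = 11 ∨ p = 13 ∨ p = 23 ∨ p = 37 ∨ p = 41 ∨ p = 83 := by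
  have h := aut_prime_spectrum hV A h01 hsymm hdiag hk hsrg hp σ hσ hσ1 hA
  have h17 : p ≠ 17 := by
    rintro rfl
    exact no_aut_order_17 hV A h01 hsymm hdiag hk hsrg σ hσ hσ1 hA
  omega

/-- **Fixed-point windows, refined** (odd primes): `3: f ≡ 3 (6), f ≤ 81` · `5: f ≡ 3 (10), f ≤ 53` · `7: {11,25,39}` ·
`11: {3,25}` · `13: {21}` · `17: none` · `23: {11}` · `37: {0}` · `41: {5}` · `83: {1}`. -/
theorem aut_prime_windows_refined (hV : Fintype.card V = 333) (A : Matrix V V ℤ)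
    (h01 : ∀ x y, A x y = 0 ∨ A x y = 1) (hsymm : ∀ x y, A y x = A x y) (hdiag : ∀ x, A x x = 0)
    (hk : ∀ x, ∑ y, A x y = 166) (hsrg : ∀ x y, ∑ z, A x z * A z y = 83 * (1 + (if x = y then 1 else 0)) - A x y)
    {p : ℕ} (hp : p.Prime) (hp2 : p ≠ 2) (σ : Equiv.Perm V) (hσ : σ ^ p = 1) (hσ1 : σ ≠ 1)
    (hA : ∀ x y, A (σ x) (σ y) = A x y) :
    let f := (univ.filter fun x => σ x = x).card
    (p = 3 → f % 6 = 3 ∧ f ≤ 81) ∧ (p = 5 → f % 10 = 3 ∧ f ≤ 53) ∧ (p = 7 → f = 11 ∨ f = 25 ∨ f = 39) ∧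
    (p = 11 → f = 3 ∨ f = 25) ∧ (p = 13 → f = 21) ∧ (p ≠ 17) ∧ (p = 23 → f = 11) ∧
    (p = 37 → f = 0) ∧ (p = 41 → f = 5) ∧ (p = 83 → f = 1) := by
  intro f
  obtain ⟨h3, -, h7, h11, -, -, h23, h37, h41, h83⟩ :=
    aut_prime_windows hV A h01 hsymm hdiag hk hsrg hp hp2 σ hσ hσ1 hA
  refine ⟨h3, fun h => ?_, h7, h11, fun h => ?_, fun h => ?_, h23, h37, h41, h83⟩
  · subst h; exact aut_order5_fixed hV A h01 hsymm hdiag hk hsrg σ hσ hσ1 hA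
  · subst h; exact aut_order13_fixed hV A h01 hsymm hdiag hk hsrg σ hσ hσ1 hA
  · subst h; exact no_aut_order_17 hV A h01 hsymm hdiag hk hsrg σ hσ hσ1 hA

end oddfixed

/-! ## §2 Composite orders `p·q` with the parities -/

section composite
variable {V : Type*} [Fintype V] [DecidableEq V]

omit [Fintype V] [DecidableEq V] in
/-- coprime exponents: `σ^a x = x` and `σ^b x = x` with `a, b` coprime, `b > 1`, force `σ x = x` (private copy of the
`CompositeOrderTools` lemma, to keep the import list short). -/
private lemma perm_fixed_of_pow_coprime_ofp (σ : Equiv.Perm V) {a b : ℕ} (hab : Nat.Coprime a b) (hb : 1 < b)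
    {x : V} (ha : (σ ^ a) x = x) (hbx : (σ ^ b) x = x) : σ x = x := by
  obtain ⟨m, -, hm⟩ := Nat.exists_mul_mod_eq_one_of_coprime hab hb
  have h1 : (σ ^ (a * m)) x = x := by rw [pow_mul]; exact Equiv.Perm.pow_apply_eq_self_of_apply_eq_self ha m
  have h2 : (σ ^ (b * (a * m / b))) x = x := by
    rw [pow_mul]; exact Equiv.Perm.pow_apply_eq_self_of_apply_eq_self hbx _
  have e : a * m = b * (a * m / b) + 1 := by
    have := Nat.div_add_mod (a * m) b
    omega
  rw [e, pow_succ', Equiv.Perm.mul_apply, h2] at h1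
  exact h1

/-- **Arithmetic facts for an automorphism of order `p·q`, with parities.**  As
`ConferenceGraph333CompositeOrders.aut_two_primes_facts` (`a = #Fix τ ≤ b = #Fix τ^p`, `c = #Fix τ^q`, `p ∣ b − a`,
`q ∣ c − a`, the prime windows for `b` (order `q`) and `c` (order `p`)), plus `b + c ≤ 333 + a`
(`Fix τ^p ∪ Fix τ^q ⊆ V`) and the PARITIES: `a` odd if `37 ∤ pq`, `b` odd if `q ≠ 37`, `c` odd if `p ≠ 37`. -/
theorem aut_two_primes_facts_odd (hV : Fintype.card V = 333) (A : Matrix V V ℤ)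
    (h01 : ∀ x y, A x y = 0 ∨ A x y = 1) (hsymm : ∀ x y, A y x = A x y) (hdiag : ∀ x, A x x = 0)
    (hk : ∀ x, ∑ y, A x y = 166) (hsrg : ∀ x y, ∑ z, A x z * A z y = 83 * (1 + (if x = y then 1 else 0)) - A x y)
    {p q : ℕ} (hp : p.Prime) (hq : q.Prime) (hpq : p < q) (τ : Equiv.Perm V) (hτ : τ ^ (p * q) = 1)
    (hτp : τ ^ p ≠ 1) (hτq : τ ^ q ≠ 1) (hA : ∀ x y, A (τ x) (τ y) = A x y) :
    ∃ a b c mb : ℕ, a ≤ b ∧ a ≤ c ∧ p ∣ b - a ∧ q ∣ c - a ∧ b + c ≤ 333 + a ∧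
      (b + q * mb = 333 ∧ 1 ≤ mb ∧ q * b + mb + q ≤ 334 ∧ (q % 4 = 3 → 2 ∣ mb ∧ q * b + mb + q + 4 ≤ 334)) ∧
      (p = 2 → c % 4 = 1) ∧
      (p ≠ 2 → ∃ mc : ℕ, c + p * mc = 333 ∧ 1 ≤ mc ∧ p * c + mc + p ≤ 334 ∧
        (p % 4 = 3 → 2 ∣ mc ∧ p * c + mc + p + 4 ≤ 334)) ∧
      (¬ 37 ∣ p * q → a % 2 = 1) ∧ (q ≠ 37 → b % 2 = 1) ∧ (p ≠ 37 → c % 2 = 1) := by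
  have hAk : ∀ (k : ℕ) x y, A ((τ ^ k) x) ((τ ^ k) y) = A x y := by
    intro k; induction k with
    | zero => intro x y; simp
    | succ k ih => intro x y; rw [pow_succ', Equiv.Perm.mul_apply, Equiv.Perm.mul_apply, hA, ih]
  have hσp : (τ ^ q) ^ p = 1 := by rw [← pow_mul, mul_comm, hτ]
  have hσq : (τ ^ p) ^ q = 1 := by rw [← pow_mul, hτ]
  have hq2 : q ≠ 2 := by have := hp.two_le; omega
  obtain ⟨b, mb, hbdef, hb⟩ := primeOrder_census hV A h01 hsymm hdiag hk hsrg hq hq2 (τ ^ p) hσq hτp (hAk p)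
  haveI : Fact p.Prime := ⟨hp⟩
  haveI hqF : Fact q.Prime := ⟨hq⟩
  have hab := card_fixed_le_card_fixed_pow τ p
  have hac := card_fixed_le_card_fixed_pow τ q
  have hdb := (Nat.modEq_iff_dvd' hab).mp (card_fixed_pow_prime_modEq τ p).symm
  have hdc := (Nat.modEq_iff_dvd' hac).mp (card_fixed_pow_prime_modEq τ q).symm
  -- union bound: Fix τ^p ∪ Fix τ^q ⊆ V with intersection Fix τ
  have hunion : (univ.filter fun x => (τ ^ p) x = x).card + (univ.filter fun x => (τ ^ q) x = x).card ≤
      333 + (univ.filter fun x => τ x = x).card := by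
    have hint : (univ.filter fun x => (τ ^ p) x = x) ∩ (univ.filter fun x => (τ ^ q) x = x) ⊆
        (univ.filter fun x => τ x = x) := by
      intro x hx
      rw [Finset.mem_inter, Finset.mem_filter, Finset.mem_filter] at hx
      rw [Finset.mem_filter]
      refine ⟨Finset.mem_univ _, ?_⟩
      exact perm_fixed_of_pow_coprime_ofp τ ((Nat.coprime_primes hp hq).mpr (Nat.ne_of_lt hpq)) hq.one_lt hx.1.2
        hx.2.2
    have h1 := Finset.card_union_add_card_inter (univ.filter fun x => (τ ^ p) x = x)
      (univ.filter fun x => (τ ^ q) x = x)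
    have h2 : ((univ.filter fun x => (τ ^ p) x = x) ∪ (univ.filter fun x => (τ ^ q) x = x)).card ≤ 333 := by
      rw [← hV, ← Finset.card_univ]; exact Finset.card_le_card (Finset.subset_univ _)
    have h3 := Finset.card_le_card hint
    omega
  -- parities
  have h37pq : ¬ 37 ∣ p * q → (univ.filter fun x => τ x = x).card % 2 = 1 := fun h =>
    (aut_card_fixed_odd hV A h01 hsymm hdiag hk hsrg τ hτ h hA).2
  have h37q : q ≠ 37 → (univ.filter fun x => (τ ^ p) x = x).card % 2 = 1 := fun h =>
    (aut_card_fixed_odd hV A h01 hsymm hdiag hk hsrg (τ ^ p) hσq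
      (fun hd => h ((Nat.prime_dvd_prime_iff_eq (by norm_num) hq).mp hd).symm) (hAk p)).2
  have h37p : p ≠ 37 → (univ.filter fun x => (τ ^ q) x = x).card % 2 = 1 := fun h =>
    (aut_card_fixed_odd hV A h01 hsymm hdiag hk hsrg (τ ^ q) hσp
      (fun hd => h ((Nat.prime_dvd_prime_iff_eq (by norm_num) hp).mp hd).symm) (hAk q)).2
  refine ⟨(univ.filter fun x => τ x = x).card, b, (univ.filter fun x => (τ ^ q) x = x).card, mb,
    hbdef ▸ hab, hac, hbdef ▸ hdb, hdc, hbdef ▸ hunion, hb, fun hp2 => ?_, fun hp2 => ?_, h37pq, hbdef ▸ h37q, h37p⟩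
  · subst hp2
    refine involution_fixedPoints_mod_four hV A h01 hsymm hdiag hk hsrg (τ ^ q) (fun x => ?_) (hAk q)
    have := congrArg (fun g : Equiv.Perm V => g x) hσp
    simpa [pow_two] using this
  · obtain ⟨c, mc, hcdef, hc⟩ := primeOrder_census hV A h01 hsymm hdiag hk hsrg hp hp2 (τ ^ q) hσp hτq (hAk q)
    exact ⟨mc, hcdef ▸ hc⟩

/-- **No automorphism of order `91 = 7·13`** (gen 28's facts leave only `(#Fix τ, #Fix τ⁷, #Fix τ¹³) = (0, 21, 39)`;
now `#Fix τ` must be odd). -/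
theorem no_aut_order_91 (hV : Fintype.card V = 333) (A : Matrix V V ℤ)
    (h01 : ∀ x y, A x y = 0 ∨ A x y = 1) (hsymm : ∀ x y, A y x = A x y) (hdiag : ∀ x, A x x = 0)
    (hk : ∀ x, ∑ y, A x y = 166) (hsrg : ∀ x y, ∑ z, A x z * A z y = 83 * (1 + (if x = y then 1 else 0)) - A x y)
    (τ : Equiv.Perm V) (hτ : τ ^ (7 * 13) = 1) (hτp : τ ^ 7 ≠ 1) (hτq : τ ^ 13 ≠ 1)
    (hA : ∀ x y, A (τ x) (τ y) = A x y) : False := by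
  obtain ⟨a, b, c, mb, hab, hac, hdb, hdc, hun, ⟨hb1, hb2, hb3, hb4⟩, -, hC, ha2, hb2', hc2⟩ :=
    aut_two_primes_facts_odd hV A h01 hsymm hdiag hk hsrg (by norm_num) (by norm_num) (by norm_num) τ hτ hτp hτq hA
  obtain ⟨mc, hc1, hc2', hc3, hc4⟩ := hC (by norm_num)
  obtain ⟨kb, hkb⟩ := hdb
  obtain ⟨kc, hkc⟩ := hdc
  have ha := ha2 (by norm_num)
  have hbo := hb2' (by norm_num)
  clear hb4
  obtain ⟨⟨jc, hjc⟩, hc5⟩ := hc4 (by norm_num)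
  omega

end composite

end Summit.Ventures.DiscreteObjects.Hadamard
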